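import Literature.Analysis.ODE.HeunEulerKernel
import HarnessLib

/-!
# Euler's transformation of Heun's equation in `τ`-form: the integrand is an exact `τ`-derivative

Topic `Literature/Analysis/ODE` (namespace `Literature.Analysis.ODE`, sub-namespace `GeneralHeun`;
continues `HeunEulerKernel.lean`, Umetsu's normalisation `M = lead ∂² + mid ∂ + low`, `low = αβ z + q`).

K. Takemura, J. Math. Soc. Japan 69 (2017) 849–891 [Takemura2017], Proposition 1.2 (Kazakov–Slavyanov):
`y(z) = ∫ v(w)(z−w)^{−η} dw` maps solutions of the source Heun equation (parameters
`γ−η+1, δ−η+1, ε−η+1; 2−η, α+β−2η+1; q'`) to solutions of the target one (`γ,δ,ε;α,β;q`), for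
`(η−α)(η−β) = 0`. The present file proves the REAL-VARIABLE core of that statement in the form in
which the one-sided transform over `(1, z)` is actually used (substitute `w = 1 + (z−1)t`,
`t ∈ (0,1)`): with

* `F(z,t) = (z−1)^{1−η}(1−t)^{−η}·v(1+(z−1)t)` (so that `∫₀¹ F(z,t) dt = ∫₁^z (z−w)^{−η} v(w) dw`),
* its first two `z`-partials `F_z`, `F_zz` (closed forms `eulerFz`, `eulerFzz`, proved in
  `hasDerivAt_eulerF`, `hasDerivAt_eulerFz`),
* the boundary form
  `G(z,t) = (z−1)^{−η}(1−t)^{1−η}·{ −[(a_H−1)(η−δ) + (2η−γ−δ−ε) t (z−1)²]·v(w) + (z−1) t [t(z−1)² + a_H − 1]·v′(w) }`,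

one has the POINTWISE identity (`euler_tau_identity`)
`lead(z) F_zz + mid_{γδε}(z) F_z + (αβ z + q) F − ∂_t G = (z−1)^{1−η}(1−t)^{−η}·(M_src v)(w)`,
valid for every twice-differentiable `v` (no equation assumed), under the Fuchs relation and
`(η−α)(η−β) = 0`; hence `M_z F = ∂_t G` when `v` solves the source equation
(`hasDerivAt_eulerG_of_source`). Consequently `M_z ∫₀¹ F dt = G(z,1⁻) − G(z,0⁺)` once
differentiation under the integral is justified, and both limits vanish exactly under the two
integrability conditions `Re η < 1` (factor `(1−t)^{1−η}`) and `Re ρ > −1` for `v ~ (w−1)^ρ`,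
`ρ = η − δ` being the non-analytic source exponent at `w = 1` (the two leading terms of `G` at
`t = 0` cancel) — that analytic step is NOT done here. This is the mechanism of the classical Euler
integral representation (e.g. of `₂F₁`); for Heun it is the content of the proof of
[Takemura2017] Prop. 1.2 / Kazakov–Slavyanov. Powers are `GeneralHeun.eulerKernel`
(`k_η(u) = exp(−η log u) = u^{−η}`, `u > 0`). No named facts; everything is proved.

Exact computer-algebra companion (pub-kds): kit j166563 (`theory/w2/w3_tau_form3.py`).

## References
* K. Takemura, J. Math. Soc. Japan 69 (2017) 849–891, Prop. 1.2. Key `Takemura2017`.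
* E. L. Ince, *Ordinary Differential Equations* (1926), §5.3 (Lagrange identity). Key `Ince1926`.
-/

noncomputable section

open Set Filter
open scoped Topology

namespace Literature.Analysis.ODE

namespace GeneralHeun

/-! ### The substitution `w = 1 + (z−1)t` and the closed forms -/

/-- The point `w = 1 + (z−1)t` of the segment `(1, z)` with parameter `t ∈ (0,1)`.
[cite: Takemura2017, Proposition 1.2] -/
def eulerPt (z t : ℝ) : ℝ := 1 + (z - 1) * t

/-- The `τ`-form integrand `F(z,t) = (z−1)^{1−η}(1−t)^{−η} v(1+(z−1)t)` of the one-sided Euler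
transform `∫₁^z (z−w)^{−η}v(w)dw = ∫₀¹ F(z,t)dt`. [cite: Takemura2017, Proposition 1.2] -/
def eulerF (η : ℂ) (v : ℝ → ℂ) (z t : ℝ) : ℂ :=
  eulerKernel (η - 1) (z - 1) * eulerKernel η (1 - t) * v (eulerPt z t)

/-- Closed form of `∂_z F`: `(z−1)^{−η}(1−t)^{−η}[(1−η) v(w) + (z−1) t v′(w)]`.
[cite: Takemura2017, Proposition 1.2] -/
def eulerFz (η : ℂ) (v v₁ : ℝ → ℂ) (z t : ℝ) : ℂ :=
  eulerKernel η (z - 1) * eulerKernel η (1 - t) *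
    ((1 - η) * v (eulerPt z t) + ((z - 1 : ℝ) : ℂ) * (t : ℂ) * v₁ (eulerPt z t))

/-- Closed form of `∂_z² F`:
`(z−1)^{−η−1}(1−t)^{−η}[−η(1−η) v(w) + 2(1−η)(z−1) t v′(w) + (z−1)² t² v″(w)]`.
[cite: Takemura2017, Proposition 1.2] -/
def eulerFzz (η : ℂ) (v v₁ v₂ : ℝ → ℂ) (z t : ℝ) : ℂ :=
  eulerKernel (η + 1) (z - 1) * eulerKernel η (1 - t) *
    (-η * (1 - η) * v (eulerPt z t) + 2 * (1 - η) * ((z - 1 : ℝ) : ℂ) * (t : ℂ) * v₁ (eulerPt z t)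
      + ((z - 1 : ℝ) : ℂ) ^ 2 * (t : ℂ) ^ 2 * v₂ (eulerPt z t))

/-- The boundary form `G(z,t)` whose `t`-derivative is `M_z F` (for a source solution `v`):
`G = (z−1)^{−η}(1−t)^{1−η}{ −[(a_H−1)(η−δ) + (2η−γ−δ−ε)t(z−1)²] v(w) + (z−1)t[t(z−1)²+a_H−1] v′(w) }`.
Here `η − δ` is the non-analytic exponent `1 − δ'` of the source equation at `w = 1`.
[cite: Takemura2017, Proposition 1.2] -/
def eulerG (aH γ δ ε η : ℂ) (v v₁ : ℝ → ℂ) (z t : ℝ) : ℂ :=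
  eulerKernel η (z - 1) * eulerKernel (η - 1) (1 - t) *
    (-((aH - 1) * (η - δ) + (2 * η - γ - δ - ε) * (t : ℂ) * ((z - 1 : ℝ) : ℂ) ^ 2) * v (eulerPt z t)
      + ((z - 1 : ℝ) : ℂ) * (t : ℂ) * ((t : ℂ) * ((z - 1 : ℝ) : ℂ) ^ 2 + aH - 1) * v₁ (eulerPt z t))

/-- The raw `t`-derivative of `G` (product and chain rules, before any use of an equation for `v`).
[cite: Takemura2017, Proposition 1.2] -/
def eulerGt (aH γ δ ε η : ℂ) (v v₁ v₂ : ℝ → ℂ) (z t : ℝ) : ℂ :=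
  eulerKernel η (z - 1) * ((η - 1) * eulerKernel η (1 - t)) *
      (-((aH - 1) * (η - δ) + (2 * η - γ - δ - ε) * (t : ℂ) * ((z - 1 : ℝ) : ℂ) ^ 2) * v (eulerPt z t)
        + ((z - 1 : ℝ) : ℂ) * (t : ℂ) * ((t : ℂ) * ((z - 1 : ℝ) : ℂ) ^ 2 + aH - 1) * v₁ (eulerPt z t))
    + eulerKernel η (z - 1) * eulerKernel (η - 1) (1 - t) *
      (-((2 * η - γ - δ - ε) * ((z - 1 : ℝ) : ℂ) ^ 2) * v (eulerPt z t)
        + -((aH - 1) * (η - δ) + (2 * η - γ - δ - ε) * (t : ℂ) * ((z - 1 : ℝ) : ℂ) ^ 2) *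
            (((z - 1 : ℝ) : ℂ) * v₁ (eulerPt z t))
        + ((z - 1 : ℝ) : ℂ) * (2 * (t : ℂ) * ((z - 1 : ℝ) : ℂ) ^ 2 + aH - 1) * v₁ (eulerPt z t)
        + ((z - 1 : ℝ) : ℂ) * (t : ℂ) * ((t : ℂ) * ((z - 1 : ℝ) : ℂ) ^ 2 + aH - 1) *
            (((z - 1 : ℝ) : ℂ) * v₂ (eulerPt z t)))

/-! ### Elementary derivatives -/

/-- `d/du k_{η−1}(u) = (1−η) k_η(u)` for `u > 0`. [cite: Takemura2017, Proposition 1.2 (kernel)] -/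
theorem hasDerivAt_eulerKernel_pred (η : ℂ) {u : ℝ} (hu : 0 < u) :
    HasDerivAt (eulerKernel (η - 1)) ((1 - η) * eulerKernel η u) u := by
  have h := hasDerivAt_eulerKernel (η - 1) hu
  rw [sub_add_cancel] at h
  refine h.congr_deriv ?_
  ring

/-- The affine map `t ↦ 1 + (z−1)t` has derivative `z − 1`. [cite: Takemura2017, Proposition 1.2] -/
theorem hasDerivAt_eulerPt_t (z t : ℝ) : HasDerivAt (fun τ : ℝ => eulerPt z τ) (z - 1) t := by
  unfold eulerPt
  simpa using ((hasDerivAt_id t).const_mul (z - 1)).const_add 1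

/-- The affine map `z ↦ 1 + (z−1)t` has derivative `t`. [cite: Takemura2017, Proposition 1.2] -/
theorem hasDerivAt_eulerPt_z (z t : ℝ) : HasDerivAt (fun ζ : ℝ => eulerPt ζ t) t z := by
  unfold eulerPt
  simpa using (((hasDerivAt_id z).sub_const 1).mul_const t).const_add 1

/-! ### The `z`-partials of `F` -/

/-- `∂_z F = eulerFz` for `z > 1`, `t < 1`, `v` differentiable at `w = 1+(z−1)t` with derivative
`v₁ w`. [cite: Takemura2017, Proposition 1.2] -/
theorem hasDerivAt_eulerF {η : ℂ} {v v₁ : ℝ → ℂ} {z t : ℝ} (hz : 1 < z)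
    (hv : HasDerivAt v (v₁ (eulerPt z t)) (eulerPt z t)) :
    HasDerivAt (fun ζ : ℝ => eulerF η v ζ t) (eulerFz η v v₁ z t) z := by
  have hz1 : 0 < z - 1 := sub_pos.mpr hz
  have hK : HasDerivAt (fun ζ : ℝ => eulerKernel (η - 1) (ζ - 1))
      ((1 - η) * eulerKernel η (z - 1)) z :=
    (hasDerivAt_eulerKernel_pred η hz1).comp_sub_const z 1
  have hV : HasDerivAt (fun ζ : ℝ => v (eulerPt ζ t)) (t • v₁ (eulerPt z t)) z :=
    hv.scomp z (hasDerivAt_eulerPt_z z t)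
  have h := (hK.mul_const (eulerKernel η (1 - t))).mul hV
  have hs : eulerKernel (η - 1) (z - 1) = ((z - 1 : ℝ) : ℂ) * eulerKernel η (z - 1) := by
    rw [← mul_eulerKernel_succ (η - 1) hz1, sub_add_cancel]
  unfold eulerF eulerFz
  refine h.congr_deriv ?_
  rw [Complex.real_smul, hs]
  ring

/-- `∂_z (∂_z F) = eulerFzz` for `z > 1`, `t < 1`, `v`, `v₁` differentiable at `w`.
[cite: Takemura2017, Proposition 1.2] -/
theorem hasDerivAt_eulerFz {η : ℂ} {v v₁ v₂ : ℝ → ℂ} {z t : ℝ} (hz : 1 < z)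
    (hv : HasDerivAt v (v₁ (eulerPt z t)) (eulerPt z t))
    (hv₁ : HasDerivAt v₁ (v₂ (eulerPt z t)) (eulerPt z t)) :
    HasDerivAt (fun ζ : ℝ => eulerFz η v v₁ ζ t) (eulerFzz η v v₁ v₂ z t) z := by
  have hz1 : 0 < z - 1 := sub_pos.mpr hz
  have hK : HasDerivAt (fun ζ : ℝ => eulerKernel η (ζ - 1)) (-η * eulerKernel (η + 1) (z - 1)) z :=
    (hasDerivAt_eulerKernel η hz1).comp_sub_const z 1
  have hV : HasDerivAt (fun ζ : ℝ => v (eulerPt ζ t)) (t • v₁ (eulerPt z t)) z :=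
    hv.scomp z (hasDerivAt_eulerPt_z z t)
  have hV₁ : HasDerivAt (fun ζ : ℝ => v₁ (eulerPt ζ t)) (t • v₂ (eulerPt z t)) z :=
    hv₁.scomp z (hasDerivAt_eulerPt_z z t)
  have hc : HasDerivAt (fun ζ : ℝ => ((ζ - 1 : ℝ) : ℂ)) 1 z := by
    have := ((hasDerivAt_id z).sub_const 1).ofReal_comp
    simpa using this
  -- inner bracket B(ζ) = (1−η) v(w) + (ζ−1) t v₁(w)
  have hB : HasDerivAt (fun ζ : ℝ => (1 - η) * v (eulerPt ζ t) +
        ((ζ - 1 : ℝ) : ℂ) * (t : ℂ) * v₁ (eulerPt ζ t))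
      ((1 - η) * (t • v₁ (eulerPt z t)) +
        (1 * (t : ℂ) * v₁ (eulerPt z t) + ((z - 1 : ℝ) : ℂ) * (t : ℂ) * (t • v₂ (eulerPt z t)))) z :=
    (hV.const_mul (1 - η)).add (((hc.mul_const (t : ℂ)).mul hV₁))
  have h := (hK.mul_const (eulerKernel η (1 - t))).mul hB
  have hs : eulerKernel η (z - 1) = ((z - 1 : ℝ) : ℂ) * eulerKernel (η + 1) (z - 1) := by
    rw [← mul_eulerKernel_succ η hz1]
  unfold eulerFz eulerFzz
  refine h.congr_deriv ?_
  simp only [Complex.real_smul]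
  rw [hs]
  ring

/-! ### The `t`-derivative of `G` and the identity -/

/-- `∂_t G = eulerGt` (raw form) for `z > 1`, `t < 1`, `v`, `v₁` differentiable at `w = 1+(z−1)t`.
[cite: Takemura2017, Proposition 1.2] -/
theorem hasDerivAt_eulerG {aH γ δ ε η : ℂ} {v v₁ v₂ : ℝ → ℂ} {z t : ℝ} (ht : t < 1)
    (hv : HasDerivAt v (v₁ (eulerPt z t)) (eulerPt z t))
    (hv₁ : HasDerivAt v₁ (v₂ (eulerPt z t)) (eulerPt z t)) :
    HasDerivAt (fun τ : ℝ => eulerG aH γ δ ε η v v₁ z τ) (eulerGt aH γ δ ε η v v₁ v₂ z t) t := by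
  have ht1 : 0 < 1 - t := sub_pos.mpr ht
  -- kernel factor in t: d/dt k_{η−1}(1−t) = −(1−η) k_η(1−t) = (η−1) k_η(1−t)
  have hK : HasDerivAt (fun τ : ℝ => eulerKernel (η - 1) (1 - τ))
      (-((1 - η) * eulerKernel η (1 - t))) t :=
    (hasDerivAt_eulerKernel_pred η ht1).comp_const_sub 1 t
  have hV : HasDerivAt (fun τ : ℝ => v (eulerPt z τ)) ((z - 1) • v₁ (eulerPt z t)) t :=
    hv.scomp t (hasDerivAt_eulerPt_t z t)
  have hV₁ : HasDerivAt (fun τ : ℝ => v₁ (eulerPt z τ)) ((z - 1) • v₂ (eulerPt z t)) t :=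
    hv₁.scomp t (hasDerivAt_eulerPt_t z t)
  have hc : HasDerivAt (fun τ : ℝ => (τ : ℂ)) 1 t := by
    simpa using (hasDerivAt_id t).ofReal_comp
  -- coefficient functions
  have hA : HasDerivAt (fun τ : ℝ =>
        -((aH - 1) * (η - δ) + (2 * η - γ - δ - ε) * (τ : ℂ) * ((z - 1 : ℝ) : ℂ) ^ 2))
      (-((2 * η - γ - δ - ε) * 1 * ((z - 1 : ℝ) : ℂ) ^ 2)) t := by
    exact (((hc.const_mul (2 * η - γ - δ - ε)).mul_const (((z - 1 : ℝ) : ℂ) ^ 2)).const_add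
      ((aH - 1) * (η - δ))).neg
  have hC : HasDerivAt (fun τ : ℝ =>
        ((z - 1 : ℝ) : ℂ) * (τ : ℂ) * ((τ : ℂ) * ((z - 1 : ℝ) : ℂ) ^ 2 + aH - 1))
      (((z - 1 : ℝ) : ℂ) * 1 * ((t : ℂ) * ((z - 1 : ℝ) : ℂ) ^ 2 + aH - 1) +
        ((z - 1 : ℝ) : ℂ) * (t : ℂ) * (1 * ((z - 1 : ℝ) : ℂ) ^ 2)) t := by
    have h1 : HasDerivAt (fun τ : ℝ => ((z - 1 : ℝ) : ℂ) * (τ : ℂ)) (((z - 1 : ℝ) : ℂ) * 1) t :=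
      hc.const_mul _
    have h2 : HasDerivAt (fun τ : ℝ => (τ : ℂ) * ((z - 1 : ℝ) : ℂ) ^ 2 + aH - 1)
        (1 * ((z - 1 : ℝ) : ℂ) ^ 2) t := by
      simpa using ((hc.mul_const (((z - 1 : ℝ) : ℂ) ^ 2)).add_const aH).sub_const 1
    exact h1.mul h2
  have hB := (hA.mul hV).add (hC.mul hV₁)
  have h := (hK.const_mul (eulerKernel η (z - 1))).mul hB
  unfold eulerG eulerGt
  refine h.congr_deriv ?_
  simp only [Pi.mul_apply, Pi.add_apply, Complex.real_smul]
  ring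

/-- **Euler's transformation in `τ`-form: the integrand identity.** For ANY twice-differentiable
`v` (values `v, v₁, v₂` at `w = 1+(z−1)t`), `z > 1`, `t < 1`, Heun parameters with the Fuchs
relation and `(η−α)(η−β) = 0`:
`lead(z)·F_zz + mid_{γδε}(z)·F_z + (αβz+q)·F − ∂_tG = (z−1)^{1−η}(1−t)^{−η}·[lead(w)v₂ + mid'(w)v₁ + low'(w)v]`,
the bracket being the SOURCE operator (`eulerSrc γ η, eulerSrc δ η, eulerSrc ε η; eulerSrcα η,
eulerSrcβ α β η; eulerSrcQ`) applied to `v` at `w`. [cite: Takemura2017, Proposition 1.2] -/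
theorem euler_tau_identity {aH α β γ δ ε q η : ℂ} (hF : γ + δ + ε = α + β + 1)
    (hη : (η - α) * (η - β) = 0) (v v₁ v₂ : ℝ → ℂ) {z t : ℝ} (hz : 1 < z) (ht : t < 1) :
    lead aH z * eulerFzz η v v₁ v₂ z t + mid aH γ δ ε z * eulerFz η v v₁ z t +
        low α β q z * eulerF η v z t - eulerGt aH γ δ ε η v v₁ v₂ z t =
      eulerKernel (η - 1) (z - 1) * eulerKernel η (1 - t) *
        (lead aH (eulerPt z t) * v₂ (eulerPt z t) +
          mid aH (eulerSrc γ η) (eulerSrc δ η) (eulerSrc ε η) (eulerPt z t) * v₁ (eulerPt z t) +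
          low (eulerSrcα η) (eulerSrcβ α β η) (eulerSrcQ aH γ δ ε q η) (eulerPt z t) *
            v (eulerPt z t)) := by
  have hz1 : 0 < z - 1 := sub_pos.mpr hz
  have ht1 : 0 < 1 - t := sub_pos.mpr ht
  -- express all kernels through k_{η+1}(z−1) and k_η(1−t)
  have hz_a : eulerKernel η (z - 1) = ((z - 1 : ℝ) : ℂ) * eulerKernel (η + 1) (z - 1) := by
    rw [← mul_eulerKernel_succ η hz1]
  have hz_b : eulerKernel (η - 1) (z - 1) = ((z - 1 : ℝ) : ℂ) ^ 2 * eulerKernel (η + 1) (z - 1) := by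
    rw [← mul_eulerKernel_succ (η - 1) hz1, sub_add_cancel, hz_a]
    ring
  have ht_b : eulerKernel (η - 1) (1 - t) = ((1 - t : ℝ) : ℂ) * eulerKernel η (1 - t) := by
    rw [← mul_eulerKernel_succ (η - 1) ht1, sub_add_cancel]
  have hβ : β = γ + δ + ε - 1 - α := by linear_combination -hF
  subst hβ
  unfold eulerFzz eulerFz eulerF eulerGt eulerPt lead mid low eulerSrc eulerSrcα eulerSrcβ eulerSrcQ
  rw [hz_a, hz_b, ht_b]
  push_cast
  rcases mul_eq_zero.mp hη with h | h
  · have hηα : η = α := sub_eq_zero.mp h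
    subst hηα
    ring
  · have hηβ : η = γ + δ + ε - 1 - α := sub_eq_zero.mp h
    subst hηβ
    ring

/-- **Consequence: for a source solution, `M_z F = ∂_t G` pointwise.** If `v` solves the source
Heun equation at `w = 1+(z−1)t` (`lead(w) v₂ + mid'(w) v₁ + low'(w) v = 0`), then
`t ↦ G(z,t)` has derivative `lead(z)F_zz + mid(z)F_z + (αβz+q)F` at `t` — so that
`M_z ∫₀¹ F dt = G(z,1⁻) − G(z,0⁺)` once differentiation under the integral sign is justified.
[cite: Takemura2017, Proposition 1.2] -/
theorem hasDerivAt_eulerG_of_source {aH α β γ δ ε q η : ℂ} (hF : γ + δ + ε = α + β + 1)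
    (hη : (η - α) * (η - β) = 0) {v v₁ v₂ : ℝ → ℂ} {z t : ℝ} (hz : 1 < z) (ht : t < 1)
    (hv : HasDerivAt v (v₁ (eulerPt z t)) (eulerPt z t))
    (hv₁ : HasDerivAt v₁ (v₂ (eulerPt z t)) (eulerPt z t))
    (hsrc : lead aH (eulerPt z t) * v₂ (eulerPt z t) +
        mid aH (eulerSrc γ η) (eulerSrc δ η) (eulerSrc ε η) (eulerPt z t) * v₁ (eulerPt z t) +
        low (eulerSrcα η) (eulerSrcβ α β η) (eulerSrcQ aH γ δ ε q η) (eulerPt z t) *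
          v (eulerPt z t) = 0) :
    HasDerivAt (fun τ : ℝ => eulerG aH γ δ ε η v v₁ z τ)
      (lead aH z * eulerFzz η v v₁ v₂ z t + mid aH γ δ ε z * eulerFz η v v₁ z t +
        low α β q z * eulerF η v z t) t := by
  have h := hasDerivAt_eulerG (aH := aH) (γ := γ) (δ := δ) (ε := ε) (η := η) ht hv hv₁
  refine h.congr_deriv ?_
  have key := euler_tau_identity hF hη v v₁ v₂ hz ht (aH := aH) (q := q)
  rw [hsrc, mul_zero] at key
  linear_combination -key

end GeneralHeun

end Literature.Analysis.ODE
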